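import Summits.BirchSwinnertonDyer.BirchSwinnertonDyer.Theorems.GenusKolyvaginAtTwoLeafCensusWallResidual
import HarnessLib

/-!
# Route `GenusKolyvaginAtTwo` (rev 59/60): THE (α) RE-GLUE TEMPLATE, CERTIFIED — `NonCMAtTwo ⟺ WALL row 1 ∧ U₂ ∧ R′`,
# with U₂ LOAD-BEARING and the residual narrowed from `OffHabitatResidualAtTwo` (22139) to R′ = «rank 1, `#Sel₂ ≠ 2`»

LEAD `bsd-line-gk2-p1` g30 (cell `bsd-f1-sign2`); `--supports stmt-BirchSwinnertonDyer-22985 --as helper` (U₂ `MinimalTwinBSDTwo`; closes nothing).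
THEOREMS ONLY (no definition, no named fact, no `sorry`); standard axioms.  **BSD is NOT proved by this file; the leaf `NonCMAtTwo`, WALL row 1
(items 19095–19098 of route `ByReductionTypeAtTwo`), U₂ (22985) and the residual stay OPEN; this is glue bookkeeping, not progress.**

WHY.  Director-bsd (687) «GK2 EXIT CHOICE (α), at the next registry touch»: type ONE new crux decl = 22139 with the cells delivered by the landed
transfer theorems carved out BY NAME, re-glue `closes` to bind WALL row 1 + U₂ + the transfer binders + the narrower residual **so that U₂ is
LOAD-BEARING in the proof term and 22139 leaves the binder list**, certify, run T1-1's idle-binder test.  This file is that certificate in advance,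
with the narrowest residual the present transfer theorems allow, written INLINE (the pen types the decl; nothing is defined here):

    R′ := ∀ (W : WeierstrassCurve ℚ) [W.IsElliptic] [W.IsGloballyMinimal], ¬ W.HasCM → W.analyticRank = 1 → Nat.card (W.selmerGroup 2) ≠ 2 → BSDp W 2

(«BSD₂ for non-CM curves of analytic rank one whose 2-Selmer group is NOT of order 2» — U₂'s complement inside the rank-one half of the leaf).

* §1 `nonCMAtTwo_of_wallRows_of_minimalTwinBSDTwo_of_rankOneResidual` — **the (α) `closes` body**: leaf ⟸ the four WALL rows + U₂ + R′, by the
  trichotomy `r_an = 0` (WALL, `Census.bsdp_rankZero_of_wallRows`) / `r_an = 1 ∧ #Sel₂ = 2` (U₂) / `r_an = 1 ∧ #Sel₂ ≠ 2` (R′).  EVERY binder is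
  load-bearing: drop U₂ and the rank-one `Sel₂`-minimal curves are uncovered; drop R′ and the other rank-one curves are; drop a WALL row and a
  reduction type at `2` of the rank-zero curves is.
* §2 lossless converses `rankOneResidual_of_nonCMAtTwo` (+ the tree's `Lossless.minimalTwinBSDTwo_of_nonCMAtTwo`, `Census.wallRows_of_nonCMAtTwo`) and
  ★ `nonCMAtTwo_iff_wallRows_and_minimalTwinBSDTwo_and_rankOneResidual` — **`NonCMAtTwo ⟺ WALL×4 ∧ U₂ ∧ R′`** (no scope is traded: the
  triple is exactly as strong as the leaf, like p783309's pair WALL ∧ 22139).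
* §3 the residual SHRINKS: `rankOneResidual_of_offHabitatResidualAtTwo` (R′ ⟸ 22139: a rank-one curve is off the habitat) and
  `offHabitatResidualAtTwo_of_wallRows_of_minimalTwinBSDTwo_of_rankOneResidual` (22139 ⟸ WALL + U₂ + R′), so «WALL ∧ 22139» (p783309) and
  «WALL ∧ U₂ ∧ R′» are the same Prop up to U₂ — the difference between them is PRECISELY U₂'s cell, now displayed as load-bearing.
NOTE for the pen (KL packets, gk2-p2 g29 p793353): the rank-one members of a Kriz–Li packet have `#Sel₂ = 2`, i.e. lie in U₂'s cell, and the
rank-zero members lie in WALL's; to make the packet theorem load-bearing too one must split U₂'s cell (packet members of (★)-anchored seeds ⟸ WALL +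
PRINT + KL; the rest ⟸ U₂), not R′.

References: [Miller2011LMS] Def. 1.1 (BSD(E,p)); [GrossZagier1986] V §2; director-bsd (680)/(683)/(687).
-/

set_option autoImplicit false
set_option linter.dupNamespace false -- `Summit.<P>.<Sub>` repeats `BirchSwinnertonDyer` (D-0017)

noncomputable section

open scoped Classical

namespace Summit.BirchSwinnertonDyer.BirchSwinnertonDyer.Theorems.GenusExact.Census

open WeierstrassCurve Literature.NumberTheory.EllipticCurves
  Summit.BirchSwinnertonDyer.BirchSwinnertonDyer.Rank1Residual
  Summit.BirchSwinnertonDyer.BirchSwinnertonDyer.Theses.GenusKolyvaginAtTwo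
open Summit.BirchSwinnertonDyer.BirchSwinnertonDyer.Theses.ByReductionTypeAtTwo
  (GoodOrdinaryRankZeroAtTwo MultiplicativeRankZeroAtTwo SupersingularRankZeroAtTwo AdditiveRankZeroAtTwo)

/-! ## §1 The (α) glue: leaf ⟸ WALL row 1 + U₂ + R′ -/

/-- **THE (α) `closes` BODY — `NonCMAtTwo` ⟸ the four WALL rows + U₂ `MinimalTwinBSDTwo` + the rank-one non-minimal residual R′** (inline):
analytic rank `0` ⟹ a WALL row (tetrachotomy at `2`, `bsdp_rankZero_of_wallRows`); analytic rank `1` with `#Sel₂(W) = 2` ⟹ U₂; analytic rank `1` with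
`#Sel₂(W) ≠ 2` ⟹ R′.  Every binder is load-bearing (director (682)/(687) idle-binder test, by construction).  CONDITIONAL: all three inputs are OPEN
route items / the residual to be typed; BSD is NOT proved. [cite: Miller2011LMS, Def. 1.1] -/
theorem nonCMAtTwo_of_wallRows_of_minimalTwinBSDTwo_of_rankOneResidual (hOrd : GoodOrdinaryRankZeroAtTwo)
    (hMult : MultiplicativeRankZeroAtTwo) (hSS : SupersingularRankZeroAtTwo) (hAdd : AdditiveRankZeroAtTwo) (hU2 : MinimalTwinBSDTwo)
    (hR' : ∀ (W : WeierstrassCurve ℚ) [W.IsElliptic] [W.IsGloballyMinimal],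
      ¬ W.HasCM → W.analyticRank = 1 → Nat.card (W.selmerGroup 2) ≠ 2 → BSDp W 2) :
    NonCMAtTwo := by
  intro W _ _ hcm hr
  rcases Nat.le_one_iff_eq_zero_or_eq_one.mp hr with h0 | h1
  · exact bsdp_rankZero_of_wallRows hOrd hMult hSS hAdd W hcm h0
  · by_cases hSel : Nat.card (W.selmerGroup 2) = 2
    · exact hU2 W hcm h1 hSel
    · exact hR' W hcm h1 hSel

/-! ## §2 Lossless: the leaf gives back R′; the triple is equivalent to the leaf -/

/-- **R′ ⟸ `NonCMAtTwo`** (R′ is the leaf restricted to analytic rank `1` and `#Sel₂ ≠ 2`; lossless). [cite: Miller2011LMS, Def. 1.1] -/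
theorem rankOneResidual_of_nonCMAtTwo (hleaf : NonCMAtTwo) :
    ∀ (W : WeierstrassCurve ℚ) [W.IsElliptic] [W.IsGloballyMinimal],
      ¬ W.HasCM → W.analyticRank = 1 → Nat.card (W.selmerGroup 2) ≠ 2 → BSDp W 2 :=
  fun W _ _ hcm hr1 _ ↦ hleaf W hcm (by rw [hr1])

/-- ★ **`NonCMAtTwo ⟺ WALL×4 ∧ U₂ ∧ R′`** — the (α) re-glue trades no scope: the leaf is EQUIVALENT to {the four rank-zero WALL rows of
`ByReductionTypeAtTwo`, U₂ `MinimalTwinBSDTwo`, the rank-one non-minimal residual R′}; compare p783309's `nonCMAtTwo_iff_wallRows_and_offHabitatResidual`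
(leaf ⟺ WALL×4 ∧ 22139).  Census only; BSD is NOT proved. [cite: Miller2011LMS, Def. 1.1] -/
theorem nonCMAtTwo_iff_wallRows_and_minimalTwinBSDTwo_and_rankOneResidual :
    NonCMAtTwo ↔ (GoodOrdinaryRankZeroAtTwo ∧ MultiplicativeRankZeroAtTwo ∧ SupersingularRankZeroAtTwo ∧ AdditiveRankZeroAtTwo) ∧
      MinimalTwinBSDTwo ∧
      (∀ (W : WeierstrassCurve ℚ) [W.IsElliptic] [W.IsGloballyMinimal],
        ¬ W.HasCM → W.analyticRank = 1 → Nat.card (W.selmerGroup 2) ≠ 2 → BSDp W 2) :=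
  ⟨fun h ↦ ⟨wallRows_of_nonCMAtTwo h, GenusSupplyNarrow.Lossless.minimalTwinBSDTwo_of_nonCMAtTwo h, rankOneResidual_of_nonCMAtTwo h⟩,
    fun h ↦ nonCMAtTwo_of_wallRows_of_minimalTwinBSDTwo_of_rankOneResidual h.1.1 h.1.2.1 h.1.2.2.1 h.1.2.2.2 h.2.1 h.2.2⟩

/-! ## §3 The residual shrinks: R′ versus `OffHabitatResidualAtTwo` (22139) -/

/-- **R′ ⟸ `OffHabitatResidualAtTwo`**: a non-CM curve of analytic rank `1` is OFF the habitat (the habitat requires analytic rank `0`), so the old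
residual (22139) already concludes `BSD₂` for it — R′ is a SUB-STATEMENT of 22139 (strictly narrower in scope: it says nothing about rank-one
`Sel₂`-minimal curves, which are U₂'s, nor about rank-zero off-habitat curves, which are WALL's). [cite: Miller2011LMS, Def. 1.1] -/
theorem rankOneResidual_of_offHabitatResidualAtTwo (hR : OffHabitatResidualAtTwo) :
    ∀ (W : WeierstrassCurve ℚ) [W.IsElliptic] [W.IsGloballyMinimal],
      ¬ W.HasCM → W.analyticRank = 1 → Nat.card (W.selmerGroup 2) ≠ 2 → BSDp W 2 := by
  intro W _ _ hcm hr1 _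
  haveI : NeZero (W.conductorNorm ℤ) := ⟨(W.conductorNorm_pos_holds).ne'⟩
  exact hR W hcm (by rw [hr1]) (fun hH ↦ absurd (hr1.symm.trans hH.1) one_ne_zero)

/-- **`OffHabitatResidualAtTwo` ⟸ WALL×4 + U₂ + R′** (through the leaf): so, GIVEN the four WALL rows, «22139» and «U₂ ∧ R′» are interchangeable —
the (α) re-glue replaces the binder 22139 by the PAIR (U₂, R′) and thereby makes U₂ load-bearing, losing and gaining nothing else.
Census only; BSD is NOT proved. [cite: Miller2011LMS, Def. 1.1] -/
theorem offHabitatResidualAtTwo_of_wallRows_of_minimalTwinBSDTwo_of_rankOneResidual (hOrd : GoodOrdinaryRankZeroAtTwo)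
    (hMult : MultiplicativeRankZeroAtTwo) (hSS : SupersingularRankZeroAtTwo) (hAdd : AdditiveRankZeroAtTwo) (hU2 : MinimalTwinBSDTwo)
    (hR' : ∀ (W : WeierstrassCurve ℚ) [W.IsElliptic] [W.IsGloballyMinimal],
      ¬ W.HasCM → W.analyticRank = 1 → Nat.card (W.selmerGroup 2) ≠ 2 → BSDp W 2) :
    OffHabitatResidualAtTwo :=
  GenusSupplyNarrow.Lossless.offHabitatResidualAtTwo_of_nonCMAtTwo
    (nonCMAtTwo_of_wallRows_of_minimalTwinBSDTwo_of_rankOneResidual hOrd hMult hSS hAdd hU2 hR')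

/-- **Given WALL row 1: `OffHabitatResidualAtTwo ⟺ U₂ ∧ R′`** — the exact content of the (α) trade in one line. Census only; BSD is NOT proved.
[cite: Miller2011LMS, Def. 1.1] -/
theorem offHabitatResidualAtTwo_iff_minimalTwinBSDTwo_and_rankOneResidual_of_wallRows (hOrd : GoodOrdinaryRankZeroAtTwo)
    (hMult : MultiplicativeRankZeroAtTwo) (hSS : SupersingularRankZeroAtTwo) (hAdd : AdditiveRankZeroAtTwo) :
    OffHabitatResidualAtTwo ↔ MinimalTwinBSDTwo ∧
      (∀ (W : WeierstrassCurve ℚ) [W.IsElliptic] [W.IsGloballyMinimal],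
        ¬ W.HasCM → W.analyticRank = 1 → Nat.card (W.selmerGroup 2) ≠ 2 → BSDp W 2) :=
  ⟨fun hR ↦
      have hleaf := nonCMAtTwo_of_wallRows_of_offHabitatResidual hOrd hMult hSS hAdd hR
      ⟨GenusSupplyNarrow.Lossless.minimalTwinBSDTwo_of_nonCMAtTwo hleaf, rankOneResidual_of_nonCMAtTwo hleaf⟩,
    fun h ↦ offHabitatResidualAtTwo_of_wallRows_of_minimalTwinBSDTwo_of_rankOneResidual hOrd hMult hSS hAdd h.1 h.2⟩

end Summit.BirchSwinnertonDyer.BirchSwinnertonDyer.Theorems.GenusExact.Census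

end
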